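import Summits.NavierStokesRegularity.NavierStokesRegularity.Theorems.LerayQuarterDissipationFiniteDissipationLiouvilleFinalTrace
import Literature.Analysis.FluidPDE.LocalLerayBackwardUniquenessFarField
import HarnessLib

/-!
# Crux `FiniteDissipationLiouville` (stmt-NavierStokesRegularity-22144): BACKWARD UNIQUENESS FROM
# SPATIAL INFINITY ON THE STRATUM — the final datum of every nonzero member has UNBOUNDED SUPPORT

Theorems file of route `LerayQuarterDissipation` (lead prover g5; `--supports` the crux: it bears on
BOTH registered stubs of the line `birth`, and its new content is exactly the WANDERING stub
`stub_pastWanderingRecurrentLiouville`). Navier–Stokes regularity is NOT proved by anything here;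
no summit is.

`𝒟 = 𝒟_{C,K}` is the finite-dissipation stratum of the crux: Type-I ancient mild fields `u` in the
KNSS gauge (`IsTypeIAncientMild C u`) whose slices obey Leray's quarter-rate dissipation law
`∫ ‖∇u(s)‖² ≤ K/√(−s)`, `s < 0`. Lead g3 proved that every member is a Lemarié-Rieusset local Leray
solution through the singular time (`exists_isLocalLeraySolutionOn_shift`) and that its
distributional trace `u(0⁻)` at the apex exists (`exists_tendsto_pairing_finalSlice`:
`∫⟪u(t), φ⟫ → L_φ` as `t → 0⁻` for every test field `φ`); the FINAL-SLICE LEAF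
(`eq_zero_of_tendsto_finalSlice`) says that a member with vanishing trace is `≡ 0`.

**This file: the trace need only vanish NEAR SPATIAL INFINITY.**

* `eq_zero_of_trace_farField_vanishing` — **THE FAR-FIELD TRACE LEAF**: if `∫⟪u(t), φ⟫ → 0` as
  `t → 0⁻` for every test field `φ` supported in `{|x| > R₁}` (some `R₁`), then `u ≡ 0` on `t < 0`.
  Proof: the shifted field is a local Leray solution on `(0, T) × ℝ³` whose final value vanishes
  outside the ball `B̄(0, R₁)`, hence `0` a.e. by the FAR-FIELD FORM of Lemarié-Rieusset's backward
  uniqueness theorem (Thm. 15.4 along Escauriaza–Seregin–Šverák 2003, §5: the vanishing of the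
  final value is used only in the far-field backward uniqueness of the vorticity, which sees the
  exterior of a ball) — `IsLocalLeraySolutionOn.ae_zero_of_farField_final_vanishing_unit`,
  `Literature/Analysis/FluidPDE/LocalLerayBackwardUniquenessFarField.lean` (this lead, p605903) —
  and everywhere by continuity.
* `eq_zero_of_traceValue_farField_zero` — the same with the hypothesis on the trace VALUES
  (`L_φ = 0` for the far-field test fields), `notSingular_of_trace_farField_vanishing` — the
  regularity form.
* PORTRAIT ENTRIES `exists_farField_trace_ne_zero_of_ne_zero` /
  `exists_farField_trace_ne_zero_of_singular`: **the final datum of every NONZERO member of 𝒟 —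
  a fortiori of every singular one, past-DSS OR past-wandering recurrent — has unbounded support:
  for every `R₁` some test field supported in `{|x| > R₁}` has a nonzero trace value.** With lead
  g4's far-field regularity through the singular time (`exists_farField_bound`,
  `trace_bounded_off_singularSet`: the trace is a bounded function off the `≤ c(K⁺)³` final-time
  singular points) this reads: the singularity of a member of `𝒟` is VISIBLE AT SPATIAL INFINITY IN
  THE FINAL DATUM, as a bounded but not eventually vanishing function. For past-DSS members the
  statement is already implied by the DSS-homogeneity of the trace (lead g3 `trace_pastDss_homogeneous`,
  lead g2 `eq_zero_of_pastDss_of_farField_decay`); its new content is the wandering stratum, where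
  it is the first far-field constraint: a counterexample to `stub_pastWanderingRecurrentLiouville`
  leaves a final datum that is nonzero arbitrarily far out.
* `finiteDissipationLiouville_iff_farFieldTrace` — bookkeeping: the crux is equivalent to its
  restriction to members whose trace does not vanish near infinity.

References: P. G. Lemarié-Rieusset, *The Navier–Stokes Problem in the 21st Century* (2016),
Thm. 15.4; L. Escauriaza, G. Seregin, V. Šverák, Russ. Math. Surveys 58 (2003), §3, Thm. 5.1, §5;
G. Seregin, Comm. Math. Phys. 312 (2012), §4.
-/

noncomputable section

-- the summit and its single sub-problem share the name (CONVENTIONS §1), as in every Theorems file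
set_option linter.dupNamespace false

namespace Summit.NavierStokesRegularity.NavierStokesRegularity.Theorems.FiniteDissipationLiouville.Birth.Apex

open MeasureTheory Set Filter Topology Metric Function TopologicalSpace
open Literature.Analysis Literature.Analysis.FluidPDE
open scoped ENNReal NNReal RealInnerProductSpace

variable {C K : ℝ} {u : ℝ → EuclideanSpace ℝ (Fin 3) → EuclideanSpace ℝ (Fin 3)}

/-! ### The far-field trace leaf -/

/-- **THE FAR-FIELD TRACE LEAF.** A member of the finite-dissipation stratum whose slices tend to
`0` in `𝒟'({|x| > R₁})` as `t → 0⁻` — `∫ ⟪u(t), φ⟫ → 0` for every smooth compactly supported field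
`φ` supported in `{|x| > R₁}` — vanishes identically on `t < 0`: the shifted field is a local Leray
solution on `(0, T) × ℝ³` whose final value vanishes outside a ball
(`exists_isLocalLeraySolutionOn_shift`), hence `0` a.e. by the far-field form of
Lemarié-Rieusset's backward uniqueness theorem
(`IsLocalLeraySolutionOn.ae_zero_of_farField_final_vanishing_unit`), hence everywhere by
continuity. -/
theorem eq_zero_of_trace_farField_vanishing (hu : IsTypeIAncientMild C u)
    (hlaw : ∀ s : ℝ, s < 0 → ∫⁻ x, ‖fderiv ℝ (u s) x‖ₑ ^ 2 ≤ ENNReal.ofReal (K / Real.sqrt (-s)))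
    {R₁ : ℝ}
    (hfinal : ∀ φ : EuclideanSpace ℝ (Fin 3) → EuclideanSpace ℝ (Fin 3),
      FunctionSpaces.IsTestFunctionOn (⊤ : Opens (EuclideanSpace ℝ (Fin 3))) φ →
        (∀ x, φ x ≠ 0 → R₁ < ‖x‖) →
        Tendsto (fun t => ∫ x, ⟪u t x, φ x⟫) (𝓝[<] 0) (𝓝 0)) :
    ∀ t < 0, ∀ x, u t x = 0 := by
  intro t ht x
  set T : ℝ := -2 * t with hT
  have hT0 : 0 < T := by rw [hT]; linarith
  obtain ⟨π, hLL⟩ := exists_isLocalLeraySolutionOn_shift hu hlaw hT0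
  have hdiv : IsWeaklyDivFree (u (-T)) := hu.isWeaklyDivFree (by linarith)
  -- far-field final vanishing of the shifted field at `t ↑ T`
  have hmap : Tendsto (fun s : ℝ => s - T) (𝓝[<] T) (𝓝[<] 0) := by
    refine tendsto_nhdsWithin_of_tendsto_nhds_of_eventually_within _ ?_ ?_
    · have h : Tendsto (fun s : ℝ => s - T) (𝓝 T) (𝓝 0) := by
        have h1 := (continuous_sub_right T).tendsto T
        simpa using h1
      exact h.mono_left nhdsWithin_le_nhds
    · filter_upwards [self_mem_nhdsWithin] with s hs
      show s - T < 0
      have hs' : s < T := hs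
      linarith
  have hfinal' : ∀ φ : EuclideanSpace ℝ (Fin 3) → EuclideanSpace ℝ (Fin 3),
      FunctionSpaces.IsTestFunctionOn (⊤ : Opens (EuclideanSpace ℝ (Fin 3))) φ →
        (∀ y, φ y ≠ 0 → R₁ < ‖y‖) →
        Tendsto (fun s => ∫ y, ⟪(fun s => u (s - T)) s y, φ y⟫) (𝓝[<] T) (𝓝 0) :=
    fun φ hφ hφsupp => (hfinal φ hφ hφsupp).comp hmap
  have hae := hLL.ae_zero_of_farField_final_vanishing_unit hT0 hdiv hfinal'
  -- continuity upgrades a.e. to everywhere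
  have hsub : Ioo 0 T ×ˢ (univ : Set (EuclideanSpace ℝ (Fin 3))) ⊆
      (fun z : ℝ × EuclideanSpace ℝ (Fin 3) => (z.1 - T, z.2)) ⁻¹' (Iio 0 ×ˢ univ) := by
    intro z hz
    exact ⟨by have := (mem_prod.1 hz).1.2; show z.1 - T < 0; linarith, mem_univ _⟩
  have hcont : ContinuousOn (fun z : ℝ × EuclideanSpace ℝ (Fin 3) => u (z.1 - T) z.2)
      (Ioo 0 T ×ˢ univ) := by
    have h1 : Continuous fun z : ℝ × EuclideanSpace ℝ (Fin 3) => (z.1 - T, z.2) := by fun_prop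
    exact (hu.continuousOn_uncurry.comp h1.continuousOn hsub :)
  have h0 := norm_le_of_ae_le_of_continuousOn (K := 0) (isOpen_Ioo.prod isOpen_univ) hcont
    (hae.mono fun z hz => by
      show ‖u (z.1 - T) z.2‖ ≤ 0
      rw [show u (z.1 - T) z.2 = 0 from hz, norm_zero])
  have hz : ((t + T, x) : ℝ × EuclideanSpace ℝ (Fin 3)) ∈
      Ioo 0 T ×ˢ (univ : Set (EuclideanSpace ℝ (Fin 3))) :=
    ⟨⟨by rw [hT]; linarith, by linarith⟩, mem_univ _⟩
  have h1 := h0 _ hz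
  simp only [add_sub_cancel_right] at h1
  exact norm_le_zero_iff.1 h1

/-- **The far-field trace leaf, trace-value form.** The distributional trace `u(0⁻)` of a member of
the stratum exists (`exists_tendsto_pairing_finalSlice`, lead g3); if all its values on the test
fields supported in `{|x| > R₁}` vanish — `L = 0` whenever `∫⟪u(t), φ⟫ → L` for such a `φ` — then
`u ≡ 0` on `t < 0`. -/
theorem eq_zero_of_traceValue_farField_zero (hu : IsTypeIAncientMild C u)
    (hlaw : ∀ s : ℝ, s < 0 → ∫⁻ x, ‖fderiv ℝ (u s) x‖ₑ ^ 2 ≤ ENNReal.ofReal (K / Real.sqrt (-s)))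
    {R₁ : ℝ}
    (hzero : ∀ φ : EuclideanSpace ℝ (Fin 3) → EuclideanSpace ℝ (Fin 3),
      FunctionSpaces.IsTestFunctionOn (⊤ : Opens (EuclideanSpace ℝ (Fin 3))) φ →
        (∀ x, φ x ≠ 0 → R₁ < ‖x‖) →
        ∀ L : ℝ, Tendsto (fun t => ∫ x, ⟪u t x, φ x⟫) (𝓝[<] 0) (𝓝 L) → L = 0) :
    ∀ t < 0, ∀ x, u t x = 0 := by
  refine eq_zero_of_trace_farField_vanishing hu hlaw (R₁ := R₁) fun φ hφ hφsupp => ?_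
  obtain ⟨L, hL⟩ := exists_tendsto_pairing_finalSlice hu hlaw hφ
  have hL0 := hzero φ hφ hφsupp L hL
  rwa [hL0] at hL

/-- **The far-field trace leaf, regularity form**: a member of the stratum whose trace vanishes
near spatial infinity is bounded at the apex (indeed `≡ 0`). -/
theorem notSingular_of_trace_farField_vanishing (hu : IsTypeIAncientMild C u)
    (hlaw : ∀ s : ℝ, s < 0 → ∫⁻ x, ‖fderiv ℝ (u s) x‖ₑ ^ 2 ≤ ENNReal.ofReal (K / Real.sqrt (-s)))
    {R₁ : ℝ}
    (hfinal : ∀ φ : EuclideanSpace ℝ (Fin 3) → EuclideanSpace ℝ (Fin 3),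
      FunctionSpaces.IsTestFunctionOn (⊤ : Opens (EuclideanSpace ℝ (Fin 3))) φ →
        (∀ x, φ x ≠ 0 → R₁ < ‖x‖) →
        Tendsto (fun t => ∫ x, ⟪u t x, φ x⟫) (𝓝[<] 0) (𝓝 0)) :
    ¬ (∀ r > 0, ∀ M : ℝ, ∃ t ∈ Set.Ioo (-(r ^ 2)) (0 : ℝ),
        ∃ x ∈ Metric.ball (0 : EuclideanSpace ℝ (Fin 3)) r, M < ‖u t x‖) := by
  intro hsing
  obtain ⟨t, ht, x, -, hM⟩ := hsing 1 one_pos 0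
  rw [eq_zero_of_trace_farField_vanishing hu hlaw hfinal t ht.2 x, norm_zero] at hM
  exact lt_irrefl _ hM

/-! ### Portrait: the final datum of a nonzero member has unbounded support -/

/-- **PORTRAIT ENTRY: the final datum of every NONZERO member of the stratum has unbounded
support.** If `u ∈ 𝒟` is not identically zero on `t < 0`, then for every `R₁` there is a test
field `φ` supported in `{|x| > R₁}` whose trace value is nonzero: `∫⟪u(t), φ⟫ → L ≠ 0` as
`t → 0⁻`. -/
theorem exists_farField_trace_ne_zero_of_ne_zero (hu : IsTypeIAncientMild C u)
    (hlaw : ∀ s : ℝ, s < 0 → ∫⁻ x, ‖fderiv ℝ (u s) x‖ₑ ^ 2 ≤ ENNReal.ofReal (K / Real.sqrt (-s)))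
    (hne : ∃ t < 0, ∃ x, u t x ≠ 0) (R₁ : ℝ) :
    ∃ (φ : EuclideanSpace ℝ (Fin 3) → EuclideanSpace ℝ (Fin 3)) (L : ℝ),
      FunctionSpaces.IsTestFunctionOn (⊤ : Opens (EuclideanSpace ℝ (Fin 3))) φ ∧
        (∀ x, φ x ≠ 0 → R₁ < ‖x‖) ∧ L ≠ 0 ∧
        Tendsto (fun t => ∫ x, ⟪u t x, φ x⟫) (𝓝[<] 0) (𝓝 L) := by
  by_contra h
  push Not at h
  obtain ⟨t, ht, x, hx⟩ := hne
  refine hx (eq_zero_of_traceValue_farField_zero hu hlaw (R₁ := R₁) ?_ t ht x)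
  intro φ hφ hφsupp L hL
  by_contra hL0
  exact h φ L hφ hφsupp hL0 hL

/-- **PORTRAIT ENTRY (both stubs): the final datum of every SINGULAR member of the stratum —
past-DSS or past-wandering recurrent — has unbounded support**: for every `R₁` some test field
supported in `{|x| > R₁}` has a nonzero trace value. The singularity of a member of `𝒟` is visible
at spatial infinity in the final datum. -/
theorem exists_farField_trace_ne_zero_of_singular (hu : IsTypeIAncientMild C u)
    (hlaw : ∀ s : ℝ, s < 0 → ∫⁻ x, ‖fderiv ℝ (u s) x‖ₑ ^ 2 ≤ ENNReal.ofReal (K / Real.sqrt (-s)))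
    (hsing : ∀ r > 0, ∀ M : ℝ, ∃ t ∈ Set.Ioo (-(r ^ 2)) (0 : ℝ),
      ∃ x ∈ Metric.ball (0 : EuclideanSpace ℝ (Fin 3)) r, M < ‖u t x‖) (R₁ : ℝ) :
    ∃ (φ : EuclideanSpace ℝ (Fin 3) → EuclideanSpace ℝ (Fin 3)) (L : ℝ),
      FunctionSpaces.IsTestFunctionOn (⊤ : Opens (EuclideanSpace ℝ (Fin 3))) φ ∧
        (∀ x, φ x ≠ 0 → R₁ < ‖x‖) ∧ L ≠ 0 ∧
        Tendsto (fun t => ∫ x, ⟪u t x, φ x⟫) (𝓝[<] 0) (𝓝 L) := by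
  refine exists_farField_trace_ne_zero_of_ne_zero hu hlaw ?_ R₁
  obtain ⟨t, ht, x, -, hM⟩ := hsing 1 one_pos 0
  refine ⟨t, ht.2, x, fun h0 => ?_⟩
  rw [h0, norm_zero] at hM
  exact lt_irrefl _ hM

/-- **The trace cannot vanish near infinity on a singular member** (contrapositive packaging for
the stubs): if `u ∈ 𝒟` is singular at the apex, then for NO radius `R₁` do all the pairings with
the test fields supported in `{|x| > R₁}` tend to `0`. -/
theorem not_trace_farField_vanishing_of_singular (hu : IsTypeIAncientMild C u)
    (hlaw : ∀ s : ℝ, s < 0 → ∫⁻ x, ‖fderiv ℝ (u s) x‖ₑ ^ 2 ≤ ENNReal.ofReal (K / Real.sqrt (-s)))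
    (hsing : ∀ r > 0, ∀ M : ℝ, ∃ t ∈ Set.Ioo (-(r ^ 2)) (0 : ℝ),
      ∃ x ∈ Metric.ball (0 : EuclideanSpace ℝ (Fin 3)) r, M < ‖u t x‖) (R₁ : ℝ) :
    ¬ ∀ φ : EuclideanSpace ℝ (Fin 3) → EuclideanSpace ℝ (Fin 3),
      FunctionSpaces.IsTestFunctionOn (⊤ : Opens (EuclideanSpace ℝ (Fin 3))) φ →
        (∀ x, φ x ≠ 0 → R₁ < ‖x‖) →
        Tendsto (fun t => ∫ x, ⟪u t x, φ x⟫) (𝓝[<] 0) (𝓝 0) :=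
  fun h => notSingular_of_trace_farField_vanishing hu hlaw h hsing

/-! ### Bookkeeping: the crux lives on members whose trace does not vanish near infinity -/

/-- **The crux is equivalent to its restriction to members whose final datum has unbounded
support** (for every `R₁` a far-field test field with nonzero trace value): members failing this
are `≡ 0` by the far-field trace leaf. -/
theorem finiteDissipationLiouville_iff_farFieldTrace :
    Theses.LerayQuarterDissipation.FiniteDissipationLiouville ↔
      ∀ (C K : ℝ) (ū : ℝ → EuclideanSpace ℝ (Fin 3) → EuclideanSpace ℝ (Fin 3)),
        IsTypeIAncientMild C ū →
        (∀ s : ℝ, s < 0 → ∫⁻ x, ‖fderiv ℝ (ū s) x‖ₑ ^ 2 ≤ ENNReal.ofReal (K / Real.sqrt (-s))) →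
        (∀ R₁ : ℝ, ∃ (φ : EuclideanSpace ℝ (Fin 3) → EuclideanSpace ℝ (Fin 3)) (L : ℝ),
          FunctionSpaces.IsTestFunctionOn (⊤ : Opens (EuclideanSpace ℝ (Fin 3))) φ ∧
            (∀ x, φ x ≠ 0 → R₁ < ‖x‖) ∧ L ≠ 0 ∧
            Tendsto (fun t => ∫ x, ⟪ū t x, φ x⟫) (𝓝[<] 0) (𝓝 L)) →
        ¬ (∀ r > 0, ∀ M : ℝ, ∃ t ∈ Set.Ioo (-(r ^ 2)) (0 : ℝ),
            ∃ x ∈ Metric.ball (0 : EuclideanSpace ℝ (Fin 3)) r, M < ‖ū t x‖) := by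
  constructor
  · intro h C K ū hū hD _
    exact h C K ū hū hD
  · intro h C K ū hū hD hsing
    exact h C K ū hū hD (exists_farField_trace_ne_zero_of_singular hū hD hsing) hsing

end Summit.NavierStokesRegularity.NavierStokesRegularity.Theorems.FiniteDissipationLiouville.Birth.Apex

end
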